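import Summits.Ventures.Crystal3D.StickySpheres.FccPieces
import HarnessLib

/-!
# Pieces of the lattice `D₃`: packings from finite sets of integer vectors, contacts by directions

HONEST FRAMING. Part of the venture `Summits/Ventures/Crystal3D` (cell `pub-crystal3d`; seat p3).
Construction-side bookkeeping, the `D₃`-coordinate twin of `StickySpheres/FccPieces.lean` (which
works in coefficients of a primitive fcc basis): for ANY finite set `S ⊂ ℤ³` lying in one parity
class of the coordinate sum (a translate of `D₃ = {v : v₀ + v₁ + v₂ even}`, the face-centred cubic
lattice with nearest neighbours at squared distance `2`), the points scaled by `1/√2` form a unit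
packing `d3Config S` of `S.card` diameter-`1` balls (parity lemma `two_le_sqNormInt_of_even` of
`StickySpheres/FccChunks.lean`), and twice its contact number is at least
`∑_{δ} shiftCount S δ = ∑_{δ} #{v ∈ S : v + δ ∈ S}` over the twelve minimal vectors `δ` of `D₃`
(`sum_shiftCount_le_two_mul_numContacts`: each present lattice neighbour is a contact neighbour;
labelling `latIdx` / `nbLabel` of `FccPieces`). Also: transport of these direction counts along an
additive injective self-map of `ℤ³` preserving `S` (`shiftCount_le_of_map`), three coordinate
symmetries `swap01`, `swap12`, `neg1`, and the `45°`-rotated square grids `layerPts` (points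
`(i − j, i + j − m, t)`) that are the horizontal layers of fcc pieces bounded by `{111}`-type
octahedra. Used by `StickySpheres/FccOctahedra.lean` (Bezdek's octahedra, `OctahedralLowerBound`).
Elementary [folklore]; nothing is claimed about ground states and no number of the cell moves.
-/

noncomputable section

open scoped BigOperators
open Finset

namespace Summit.Ventures.Crystal3D

open Literature.Geometry.DiscreteGeometry (sqNormInt)
open Literature.Barriers.AtomisticToContinuum (intConfig)

/-! ## Pieces of `D₃`: finite sets of integer vectors in one parity class -/

/-- The twelve minimal vectors of the lattice `D₃ = {v ∈ ℤ³ : v₀ + v₁ + v₂ even}` (nearest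
neighbours, squared length `2`): the permutations of `(±1, ±1, 0)`. -/
def d3Offsets : Finset (Fin 3 → ℤ) :=
  {![1, 1, 0], ![1, -1, 0], ![-1, 1, 0], ![-1, -1, 0], ![1, 0, 1], ![1, 0, -1], ![-1, 0, 1],
    ![-1, 0, -1], ![0, 1, 1], ![0, 1, -1], ![0, -1, 1], ![0, -1, -1]}

/-- There are twelve minimal vectors. -/
theorem card_d3Offsets : d3Offsets.card = 12 := by decide

/-- Each minimal vector has squared length `2`. -/
theorem sqNormInt_d3Offsets : ∀ δ ∈ d3Offsets, sqNormInt δ = 2 := by decide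

/-- Minimal vectors are non-zero. -/
theorem d3Offsets_ne_zero : ∀ δ ∈ d3Offsets, δ ≠ 0 := by decide

/-- **Lattice contacts of `S` in direction `δ`**: the number of `v ∈ S` with `v + δ ∈ S`. -/
def shiftCount (S : Finset (Fin 3 → ℤ)) (δ : Fin 3 → ℤ) : ℕ :=
  (S.filter fun a => a + δ ∈ S).card

variable (S : Finset (Fin 3 → ℤ))

/-- Integer model of the piece carried by `S`: label `i ↦` the `i`-th vector of `S`
(labelling `latIdx` of `StickySpheres/FccPieces.lean`). -/
def d3Int (i : Fin S.card) : Fin 3 → ℤ :=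
  ((latIdx S i : S) : Fin 3 → ℤ)

/-- **The `D₃` piece carried by `S`** (diameter-`1` balls): the integer model scaled by `1/√2`. -/
def d3Config : Fin S.card → EuclideanSpace ℝ (Fin 3) :=
  intConfig (d3Int S) (1 / Real.sqrt (2 : ℕ))

variable {S}

/-- Within one parity class of coordinate sums, distinct integer vectors are at squared distance
`≥ 2` (parity lemma `two_le_sqNormInt_of_even`). -/
theorem sep_d3Config (hS : ∀ v ∈ S, ∀ w ∈ S, (2 : ℤ) ∣ v 0 + v 1 + v 2 - (w 0 + w 1 + w 2)) :
    ∀ i j : Fin S.card, i ≠ j → (2 : ℤ) ≤ sqNormInt (d3Int S i - d3Int S j) := by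
  intro i j hij
  refine two_le_sqNormInt_of_even ?_ ?_
  · intro h
    exact hij ((latIdx S).injective (Subtype.ext (sub_eq_zero.1 h)))
  · have := hS _ (latIdx S i).2 _ (latIdx S j).2
    simp only [d3Int, Pi.sub_apply] at this ⊢
    omega

/-- A `D₃` piece in one parity class is a unit packing. -/
theorem isUnitPacking_d3Config
    (hS : ∀ v ∈ S, ∀ w ∈ S, (2 : ℤ) ∣ v 0 + v 1 + v 2 - (w 0 + w 1 + w 2)) :
    IsUnitPacking (d3Config S) :=
  isUnitPacking_intConfig (d3Int S) (by norm_num) (sep_d3Config hS)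

/-- A lattice neighbour present in `S` is a contact neighbour in the packing (`nbLabel` of
`StickySpheres/FccPieces.lean` is the label of `a_i + δ`). -/
theorem nbLabel_mem_contactNeighbors_d3 {i : Fin S.card} {δ : Fin 3 → ℤ} (hδ : δ ∈ d3Offsets)
    (h : ((latIdx S i : S) : Fin 3 → ℤ) + δ ∈ S) :
    nbLabel i δ ∈ contactNeighbors (d3Config S) i := by
  rw [mem_contactNeighbors]
  have hc := coe_latIdx_nbLabel h
  refine ⟨?_, ?_⟩
  · intro he
    rw [he] at hc
    apply d3Offsets_ne_zero δ hδ
    have : ((latIdx S i : S) : Fin 3 → ℤ) + δ = ((latIdx S i : S) : Fin 3 → ℤ) + 0 := by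
      rw [add_zero]; exact hc.symm
    exact add_left_cancel this
  · rw [d3Config, dist_intConfig_inv_sqrt (d3Int S) (by norm_num : 0 < 2)]
    have hdiff : d3Int S i - d3Int S (nbLabel i δ) = -δ := by
      rw [d3Int, d3Int, hc]; abel
    rw [hdiff, sqNormInt_neg, sqNormInt_d3Offsets δ hδ]
    norm_num

/-- Distinct present minimal vectors give distinct contact neighbours. -/
theorem nbLabel_injOn_d3 (i : Fin S.card) :
    Set.InjOn (nbLabel i) ↑(d3Offsets.filter fun δ => ((latIdx S i : S) : Fin 3 → ℤ) + δ ∈ S) := by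
  intro δ hδ δ' hδ' he
  have h1 := coe_latIdx_nbLabel (mem_filter.1 hδ).2
  have h2 := coe_latIdx_nbLabel (mem_filter.1 hδ').2
  rw [he] at h1
  rw [h1] at h2
  exact add_left_cancel h2

/-- **Each ball has at least as many contacts as lattice neighbours present in `S`.** -/
theorem card_filter_d3Offsets_le_coordination (i : Fin S.card) :
    (d3Offsets.filter fun δ => ((latIdx S i : S) : Fin 3 → ℤ) + δ ∈ S).card ≤
      coordination (d3Config S) i := by
  rw [coordination]
  exact card_le_card_of_injOn (nbLabel i)
    (fun δ hδ => nbLabel_mem_contactNeighbors_d3 (mem_filter.1 hδ).1 (mem_filter.1 hδ).2)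
    (nbLabel_injOn_d3 i)

/-- **Contact count by lattice directions**: `∑_{δ} #{v ∈ S : v + δ ∈ S} ≤ 2 · C(d3Config S)`,
the sum over the twelve minimal vectors of `D₃`. -/
theorem sum_shiftCount_le_two_mul_numContacts :
    ∑ δ ∈ d3Offsets, shiftCount S δ ≤ 2 * numContacts (d3Config S) := by
  classical
  have hswap : ∑ δ ∈ d3Offsets, shiftCount S δ =
      ∑ a ∈ S, (d3Offsets.filter fun δ => a + δ ∈ S).card := by
    simp only [shiftCount, card_filter]
    exact Finset.sum_comm
  have hlab : ∑ a ∈ S, (d3Offsets.filter fun δ => a + δ ∈ S).card =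
      ∑ i : Fin S.card, (d3Offsets.filter
        fun δ => ((latIdx S i : S) : Fin 3 → ℤ) + δ ∈ S).card := by
    rw [← Finset.sum_coe_sort S]
    exact (Fintype.sum_equiv (latIdx S) _ _ fun i => rfl).symm
  rw [hswap, hlab, ← sum_coordination_eq]
  exact sum_le_sum fun i _ => card_filter_d3Offsets_le_coordination i

/-- **Transport of lattice-contact counts along a symmetry**: an additive injective map `g` of
`ℤ³` with `g S ⊆ S` carries `{v ∈ S : v + δ ∈ S}` into `{v ∈ S : v + g δ ∈ S}`. -/
theorem shiftCount_le_of_map {g : (Fin 3 → ℤ) → (Fin 3 → ℤ)}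
    (hadd : ∀ v w, g (v + w) = g v + g w) (hinj : Function.Injective g)
    (hg : ∀ v ∈ S, g v ∈ S) (δ : Fin 3 → ℤ) :
    shiftCount S δ ≤ shiftCount S (g δ) := by
  classical
  unfold shiftCount
  calc (S.filter fun a => a + δ ∈ S).card = ((S.filter fun a => a + δ ∈ S).image g).card :=
        (card_image_of_injective _ hinj).symm
    _ ≤ (S.filter fun a => a + g δ ∈ S).card := card_le_card fun b hb => by
        obtain ⟨a, ha, rfl⟩ := mem_image.1 hb
        obtain ⟨haS, haδ⟩ := mem_filter.1 ha
        exact mem_filter.2 ⟨hg a haS, by rw [← hadd]; exact hg _ haδ⟩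

/-! ## Three coordinate symmetries of `ℤ³` -/

/-- Swap of the first two coordinates. -/
def swap01 (v : Fin 3 → ℤ) : Fin 3 → ℤ := ![v 1, v 0, v 2]

/-- Swap of the last two coordinates. -/
def swap12 (v : Fin 3 → ℤ) : Fin 3 → ℤ := ![v 0, v 2, v 1]

/-- Sign change of the middle coordinate. -/
def neg1 (v : Fin 3 → ℤ) : Fin 3 → ℤ := ![v 0, -v 1, v 2]

/-- `swap01` is additive. -/
theorem swap01_add (v w : Fin 3 → ℤ) : swap01 (v + w) = swap01 v + swap01 w := by
  ext k; fin_cases k <;> simp [swap01]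

/-- `swap12` is additive. -/
theorem swap12_add (v w : Fin 3 → ℤ) : swap12 (v + w) = swap12 v + swap12 w := by
  ext k; fin_cases k <;> simp [swap12]

/-- `neg1` is additive. -/
theorem neg1_add (v w : Fin 3 → ℤ) : neg1 (v + w) = neg1 v + neg1 w := by
  ext k; fin_cases k <;> simp [neg1, add_comm]

/-- `swap01` is injective. -/
theorem swap01_injective : Function.Injective swap01 := by
  intro v w h
  have h0 := congrFun h 0; have h1 := congrFun h 1; have h2 := congrFun h 2
  simp [swap01] at h0 h1 h2
  ext k; fin_cases k <;> simp [h0, h1, h2]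

/-- `swap12` is injective. -/
theorem swap12_injective : Function.Injective swap12 := by
  intro v w h
  have h0 := congrFun h 0; have h1 := congrFun h 1; have h2 := congrFun h 2
  simp [swap12] at h0 h1 h2
  ext k; fin_cases k <;> simp [h0, h1, h2]

/-- `neg1` is injective. -/
theorem neg1_injective : Function.Injective neg1 := by
  intro v w h
  have h0 := congrFun h 0; have h1 := congrFun h 1; have h2 := congrFun h 2
  simp [neg1] at h0 h1 h2
  ext k; fin_cases k <;> simp [h0, h1, h2]

/-! ## Square layers -/

/-- The layer point `(i − j, i + j − m, t)`: for `0 ≤ i, j ≤ m` these are the `(m+1)²` points of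
the `45°`-rotated square grid of `D₃`-side `√2` with `ℓ¹`-radius `m` at height `t`. -/
def layerPt (m t : ℤ) (p : ℕ × ℕ) : Fin 3 → ℤ :=
  ![(p.1 : ℤ) - p.2, (p.1 : ℤ) + p.2 - m, t]

/-- The third coordinate of a layer point is its height. -/
@[simp] theorem layerPt_apply_two (m t : ℤ) (p : ℕ × ℕ) : layerPt m t p 2 = t := by
  simp [layerPt]

/-- `layerPt m t` is injective (`i − j` and `i + j` determine `i`, `j`). -/
theorem layerPt_injective (m t : ℤ) : Function.Injective (layerPt m t) := by
  intro p q h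
  have h0 := congrFun h 0
  have h1 := congrFun h 1
  simp only [layerPt, Matrix.cons_val_zero, Matrix.cons_val_one] at h0 h1
  ext <;> omega

/-- The grid points `layerPt m t (i, j)` with `i < a`, `j < b`. -/
def layerPts (a b : ℕ) (m t : ℤ) : Finset (Fin 3 → ℤ) :=
  (range a ×ˢ range b).image (layerPt m t)

/-- Membership in a grid. -/
theorem mem_layerPts {a b : ℕ} {m t : ℤ} {v : Fin 3 → ℤ} :
    v ∈ layerPts a b m t ↔ ∃ i j : ℕ, i < a ∧ j < b ∧ layerPt m t (i, j) = v := by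
  simp only [layerPts, mem_image, mem_product, mem_range, Prod.exists]
  constructor
  · rintro ⟨i, j, ⟨hi, hj⟩, h⟩; exact ⟨i, j, hi, hj, h⟩
  · rintro ⟨i, j, hi, hj, h⟩; exact ⟨i, j, ⟨hi, hj⟩, h⟩

/-- A grid has `a · b` points. -/
theorem card_layerPts (a b : ℕ) (m t : ℤ) : (layerPts a b m t).card = a * b := by
  rw [layerPts, card_image_of_injective _ (layerPt_injective m t), card_product, card_range,
    card_range]

/-- Points of a grid at height `t` have third coordinate `t`. -/
theorem apply_two_of_mem_layerPts {a b : ℕ} {m t : ℤ} {v : Fin 3 → ℤ}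
    (hv : v ∈ layerPts a b m t) : v 2 = t := by
  obtain ⟨i, j, -, -, rfl⟩ := mem_layerPts.1 hv
  exact layerPt_apply_two m t (i, j)

/-- Grids at different heights are disjoint. -/
theorem disjoint_layerPts {a b a' b' : ℕ} {m m' t t' : ℤ} (h : t ≠ t') :
    Disjoint (layerPts a b m t) (layerPts a' b' m' t') :=
  disjoint_left.2 fun _ hv hv' =>
    h ((apply_two_of_mem_layerPts hv).symm.trans (apply_two_of_mem_layerPts hv'))

end Summit.Ventures.Crystal3D

end
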